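import Summits.BirchSwinnertonDyer.BirchSwinnertonDyer.Theorems.Rank2Observatory2DescClSplitImageClass
import HarnessLib

/-!
# BirchSwinnertonDyer — rank ≥ 2 observatory: KERNEL-2DESC-CL — THE ℓ-ADIC SQUARE-CLASS MAP (M1)

HONEST FRAMING: per-curve certified theorems and census instruments; no claim on BSD in rank ≥ 2.

Construction of a term `sqClassMapOdd ℓ : SqClassMapOdd ℓ` of the interface of `…SplitImageClass`, for every
prime `ℓ`: for `z ∈ ℚ_ℓ^×` with `v = v_ℓ(z)` and unit part `u = z·ℓ^{−v} ∈ ℤ_ℓ^×`,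
`cls z = (v mod 2, [χ(ū) = −1])` where `ū ∈ ℤ/ℓ` is the image of `u` under `PadicInt.toZMod` and `χ` is the
quadratic character of `ℤ/ℓ` (so that on integers the second bit is the Legendre symbol, `legendreSym`).
Multiplicativity: valuations add, `ū` is multiplicative with non-zero values, and `χ` is a character with values
`±1` there.  Local constancy on `a + ℓ^M ℤ_ℓ` (`a ∈ ℤ ∖ 0`, `v = v_ℓ(a) < M`): the valuation is `v`
(ultrametric inequality) and the unit part is `a/ℓ^v + ℓ^{M−v} t`, so `ū = a/ℓ^v mod ℓ`.
No exactness statement is made or needed (the rank bound only uses that `cls` kills squares; at `ℓ = 2` the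
term exists too but the kernel uses the finer interface `SqClassMapTwo`).

Sorry-free; axioms `propext`, `Classical.choice`, `Quot.sound`.
[cite: Cassels1991LecturesEllipticCurves, §15]
-/

set_option linter.dupNamespace false
set_option autoImplicit false

namespace Summit.BirchSwinnertonDyer.BirchSwinnertonDyer.Rank2Observatory.TwoDescCl.SqClassOdd

open Summit.BirchSwinnertonDyer.BirchSwinnertonDyer.Rank2Observatory.TwoDescCl.SplitImage

variable {ℓ : ℕ} [hp : Fact ℓ.Prime]

/-! ## §1 The quadratic-character bit on `ℤ/ℓ` -/

/-- The non-square bit of a residue: `[χ(r) = −1]`, `χ` the quadratic character of `ℤ/ℓ`. [cite: Cohen1993, §1.4.2] -/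
def nsqBit (r : ZMod ℓ) : Bool := decide (quadraticChar (ZMod ℓ) r = -1)

/-- On non-zero residues the non-square bit is a character (XOR). [cite: Cohen1993, §1.4.2] -/
theorem nsqBit_mul {r s : ZMod ℓ} (hr : r ≠ 0) (hs : s ≠ 0) :
    nsqBit (r * s) = (nsqBit r != nsqBit s) := by
  unfold nsqBit
  rw [map_mul]
  rcases quadraticChar_dichotomy hr with h1 | h1 <;> rcases quadraticChar_dichotomy hs with h2 | h2 <;>
    norm_num [h1, h2]

/-- On an integer residue the non-square bit is the Legendre bit. [cite: Cohen1993, §1.4.2] -/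
theorem nsqBit_intCast (u : ℤ) : nsqBit ((u : ℤ) : ZMod ℓ) = decide (legendreSym ℓ u = -1) := rfl

/-! ## §2 The unit part of an ℓ-adic number and its residue modulo ℓ -/

/-- The unit part `z · ℓ^{−v_ℓ(z)}` of an ℓ-adic number (`0 ↦ 0`). [folklore] -/
noncomputable def unitQ (z : ℚ_[ℓ]) : ℚ_[ℓ] := z * (ℓ : ℚ_[ℓ]) ^ (-z.valuation)

/-- The unit part of a non-zero ℓ-adic number has norm 1. [folklore] -/
theorem norm_unitQ {z : ℚ_[ℓ]} (hz : z ≠ 0) : ‖unitQ z‖ = 1 := by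
  have h1 : (1 : ℝ) < ℓ := Nat.one_lt_cast.mpr hp.out.one_lt
  rw [unitQ, norm_mul, Padic.norm_p_zpow, Padic.norm_eq_zpow_neg_valuation hz, neg_neg,
    ← zpow_add₀ (ne_of_gt (lt_trans zero_lt_one h1)), neg_add_cancel, zpow_zero]

/-- The unit part has norm at most 1. [folklore] -/
theorem norm_unitQ_le (z : ℚ_[ℓ]) : ‖unitQ z‖ ≤ 1 := by
  by_cases hz : z = 0
  · rw [unitQ, hz, zero_mul, norm_zero]; exact zero_le_one
  · exact (norm_unitQ hz).le

/-- The unit part is multiplicative. [folklore] -/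
theorem unitQ_mul {z w : ℚ_[ℓ]} (hz : z ≠ 0) (hw : w ≠ 0) : unitQ (z * w) = unitQ z * unitQ w := by
  rw [unitQ, unitQ, unitQ, Padic.valuation_mul hz hw, neg_add,
    zpow_add₀ (Nat.cast_ne_zero.mpr hp.out.ne_zero : (ℓ : ℚ_[ℓ]) ≠ 0)]
  ring

/-- The unit part as an element of `ℤ_ℓ`. [folklore] -/
noncomputable def unitZ (z : ℚ_[ℓ]) : ℤ_[ℓ] := ⟨unitQ z, norm_unitQ_le z⟩

/-- `unitZ` is multiplicative on `ℚ_ℓ^×`. [folklore] -/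
theorem unitZ_mul {z w : ℚ_[ℓ]} (hz : z ≠ 0) (hw : w ≠ 0) : unitZ (z * w) = unitZ z * unitZ w :=
  Subtype.ext (by rw [PadicInt.coe_mul]; exact unitQ_mul hz hw)

/-- The unit part of a non-zero number is a unit of `ℤ_ℓ`. [folklore] -/
theorem isUnit_unitZ {z : ℚ_[ℓ]} (hz : z ≠ 0) : IsUnit (unitZ z) :=
  PadicInt.isUnit_iff.mpr (norm_unitQ hz)

/-- The residue modulo `ℓ` of the unit part. [folklore] -/
noncomputable def resL (z : ℚ_[ℓ]) : ZMod ℓ := PadicInt.toZMod (unitZ z)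

/-- `resL` is multiplicative on `ℚ_ℓ^×`. [folklore] -/
theorem resL_mul {z w : ℚ_[ℓ]} (hz : z ≠ 0) (hw : w ≠ 0) : resL (z * w) = resL z * resL w := by
  rw [resL, unitZ_mul hz hw, map_mul]; rfl

/-- `resL` of a non-zero number is non-zero. [folklore] -/
theorem resL_ne_zero {z : ℚ_[ℓ]} (hz : z ≠ 0) : resL z ≠ 0 :=
  ((isUnit_unitZ hz).map PadicInt.toZMod).ne_zero

/-! ## §3 The class map and its multiplicativity -/

/-- The ℓ-adic square class of `z` as two bits `(v mod 2, [χ(ū) = −1])`. [cite: Cassels1991LecturesEllipticCurves, §15] -/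
noncomputable def clsOdd (z : ℚ_[ℓ]) : Bool × Bool :=
  (decide (z.valuation % 2 = 1), nsqBit (resL z))

/-- Multiplicativity of `clsOdd` on `ℚ_ℓ^×` (componentwise XOR). [cite: Cassels1991LecturesEllipticCurves, §15] -/
theorem clsOdd_mul (z w : ℚ_[ℓ]) (hz : z ≠ 0) (hw : w ≠ 0) :
    clsOdd (z * w) = ((clsOdd z).1 != (clsOdd w).1, (clsOdd z).2 != (clsOdd w).2) := by
  simp only [clsOdd]
  have hpar : ∀ a b : ℤ, decide ((a + b) % 2 = 1) = (decide (a % 2 = 1) != decide (b % 2 = 1)) := by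
    intro a b
    rcases Int.emod_two_eq_zero_or_one a with ha | ha <;> rcases Int.emod_two_eq_zero_or_one b with hb | hb <;>
      simp [Int.add_emod, ha, hb]
  rw [Padic.valuation_mul hz hw, resL_mul hz hw, nsqBit_mul (resL_ne_zero hz) (resL_ne_zero hw), hpar]

/-! ## §4 Local constancy on a coset `a + ℓ^M ℤ_ℓ` -/

/-- On `a + ℓ^M ℤ_ℓ` with `v_ℓ(a) < M` the valuation is `v_ℓ(a)` (and the element is non-zero). [folklore] -/
theorem valuation_of_approx {z : ℚ_[ℓ]} {a : ℤ} {M : ℕ} {t : ℤ_[ℓ]} (ha : a ≠ 0) (hM : padicValInt ℓ a < M)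
    (hz : z = (a : ℚ_[ℓ]) + (ℓ : ℚ_[ℓ]) ^ M * (t : ℚ_[ℓ])) : z ≠ 0 ∧ z.valuation = padicValInt ℓ a := by
  have ha' : (a : ℚ_[ℓ]) ≠ 0 := Int.cast_ne_zero.mpr ha
  have h1 : (1 : ℝ) < ℓ := Nat.one_lt_cast.mpr hp.out.one_lt
  have hna : ‖(a : ℚ_[ℓ])‖ = (ℓ : ℝ) ^ (-(padicValInt ℓ a : ℤ)) := by
    rw [Padic.norm_eq_zpow_neg_valuation ha', Padic.valuation_intCast]
  have hnt : ‖(ℓ : ℚ_[ℓ]) ^ M * (t : ℚ_[ℓ])‖ < ‖(a : ℚ_[ℓ])‖ := by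
    rw [norm_mul, norm_pow, Padic.norm_p, hna]
    calc (ℓ : ℝ)⁻¹ ^ M * ‖(t : ℚ_[ℓ])‖ ≤ (ℓ : ℝ)⁻¹ ^ M * 1 := by gcongr; exact t.2
      _ = (ℓ : ℝ) ^ (-(M : ℤ)) := by rw [mul_one, zpow_neg, zpow_natCast, inv_pow]
      _ < (ℓ : ℝ) ^ (-(padicValInt ℓ a : ℤ)) := by
          apply zpow_lt_zpow_right₀ h1; omega
  have hzn : ‖z‖ = ‖(a : ℚ_[ℓ])‖ := by
    rw [hz, Padic.add_eq_max_of_ne (ne_of_gt hnt), max_eq_left hnt.le]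
  have hz0 : z ≠ 0 := by
    intro h; rw [h, norm_zero] at hzn; exact ha' (norm_eq_zero.mp hzn.symm)
  refine ⟨hz0, ?_⟩
  have key := Padic.norm_eq_zpow_neg_valuation hz0
  rw [hzn, hna] at key
  have hinj := zpow_right_injective₀ (lt_trans zero_lt_one h1) (ne_of_gt h1) key
  simp only [neg_inj] at hinj
  exact hinj.symm

/-- On `a + ℓ^M ℤ_ℓ` with `v = v_ℓ(a) < M` the unit part is `a/ℓ^v + ℓ^{M−v} t`. [folklore] -/
theorem unitZ_of_approx {z : ℚ_[ℓ]} {a : ℤ} {M : ℕ} {t : ℤ_[ℓ]} (ha : a ≠ 0) (hM : padicValInt ℓ a < M)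
    (hz : z = (a : ℚ_[ℓ]) + (ℓ : ℚ_[ℓ]) ^ M * (t : ℚ_[ℓ])) :
    unitZ z = ((a / (ℓ : ℤ) ^ padicValInt ℓ a : ℤ) : ℤ_[ℓ]) + (ℓ : ℤ_[ℓ]) ^ (M - padicValInt ℓ a) * t := by
  obtain ⟨hz0, hval⟩ := valuation_of_approx ha hM hz
  set v : ℕ := padicValInt ℓ a with hv
  set u : ℤ := a / (ℓ : ℤ) ^ v with hu
  obtain ⟨d, hd⟩ := Nat.exists_eq_add_of_le hM.le
  have hdv : M - v = d := by omega
  have hdvd : (ℓ : ℤ) ^ v ∣ a := padicValInt_dvd (p := ℓ) a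
  have hau : a = u * (ℓ : ℤ) ^ v := by rw [hu, Int.ediv_mul_cancel hdvd]
  have hauq : (a : ℚ_[ℓ]) = (u : ℚ_[ℓ]) * (ℓ : ℚ_[ℓ]) ^ v := by
    have h := congrArg (Int.cast : ℤ → ℚ_[ℓ]) hau
    push_cast at h; exact h
  have hvv : (ℓ : ℚ_[ℓ]) ^ v * (ℓ : ℚ_[ℓ]) ^ (-(v : ℤ)) = 1 := by
    rw [zpow_neg, zpow_natCast,
      mul_inv_cancel₀ (pow_ne_zero _ (Nat.cast_ne_zero.mpr hp.out.ne_zero : (ℓ : ℚ_[ℓ]) ≠ 0))]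
  have key : unitQ z = (u : ℚ_[ℓ]) * ((ℓ : ℚ_[ℓ]) ^ v * (ℓ : ℚ_[ℓ]) ^ (-(v : ℤ))) +
      (ℓ : ℚ_[ℓ]) ^ d * (t : ℚ_[ℓ]) * ((ℓ : ℚ_[ℓ]) ^ v * (ℓ : ℚ_[ℓ]) ^ (-(v : ℤ))) := by
    rw [unitQ, hval, hz, hauq, hd]; ring
  rw [hvv, mul_one, mul_one] at key
  apply Subtype.ext
  rw [hdv]
  show unitQ z = (((u : ℤ_[ℓ]) + (ℓ : ℤ_[ℓ]) ^ d * t : ℤ_[ℓ]) : ℚ_[ℓ])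
  rw [key]; push_cast [PadicInt.coe_natCast]; ring

/-- On `a + ℓ^M ℤ_ℓ` with `v = v_ℓ(a) < M`: `resL z = a/ℓ^v mod ℓ`. [folklore] -/
theorem resL_of_approx {z : ℚ_[ℓ]} {a : ℤ} {M : ℕ} {t : ℤ_[ℓ]} (ha : a ≠ 0) (hM : padicValInt ℓ a < M)
    (hz : z = (a : ℚ_[ℓ]) + (ℓ : ℚ_[ℓ]) ^ M * (t : ℚ_[ℓ])) :
    resL z = ((a / (ℓ : ℤ) ^ padicValInt ℓ a : ℤ) : ZMod ℓ) := by
  rw [resL, unitZ_of_approx ha hM hz, map_add, map_mul, map_pow, map_intCast, map_natCast, ZMod.natCast_self,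
    zero_pow (by omega), zero_mul, add_zero]

/-- **Local constancy**: on `a + ℓ^M ℤ_ℓ`, `v_ℓ(a) < M`, the class is read off the integer `a`.
[cite: Cassels1991LecturesEllipticCurves, §15] -/
theorem clsOdd_approx (z : ℚ_[ℓ]) (a : ℤ) (M : ℕ) (t : ℤ_[ℓ]) (ha : a ≠ 0) (hM : padicValInt ℓ a < M)
    (hz : z = (a : ℚ_[ℓ]) + (ℓ : ℚ_[ℓ]) ^ M * (t : ℚ_[ℓ])) :
    clsOdd z = (decide (padicValInt ℓ a % 2 = 1),
      decide (legendreSym ℓ (a / (ℓ : ℤ) ^ padicValInt ℓ a) = -1)) := by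
  obtain ⟨-, hval⟩ := valuation_of_approx ha hM hz
  have h : ((padicValInt ℓ a : ℕ) : ℤ) % 2 = 1 ↔ padicValInt ℓ a % 2 = 1 := by omega
  have h1 : decide (z.valuation % 2 = 1) = decide (padicValInt ℓ a % 2 = 1) := by
    rw [hval]
    by_cases hq : padicValInt ℓ a % 2 = 1
    · rw [decide_eq_true (h.mpr hq), decide_eq_true hq]
    · rw [decide_eq_false (fun h' => hq (h.mp h')), decide_eq_false hq]
  simp only [clsOdd, h1, resL_of_approx ha hM hz, nsqBit_intCast]

/-! ## §5 The term of the interface -/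

variable (ℓ) in
/-- **THE ℓ-ADIC SQUARE-CLASS MAP** (M1): a term of the interface `SqClassMapOdd ℓ` of `…SplitImageClass`, for
every prime `ℓ`.  With it, `vecOdd_mem_splitImgOdd (sqClassMapOdd ℓ) …` is an unconditional statement about
`ℚ_ℓ`-points (`ℓ` odd).  [cite: Cassels1991LecturesEllipticCurves, §15] -/
noncomputable def sqClassMapOdd : SqClassMapOdd ℓ where
  cls := clsOdd
  cls_mul := clsOdd_mul
  cls_approx := clsOdd_approx

/-- The class map of `sqClassMapOdd ℓ` is `clsOdd`. [folklore] -/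
theorem sqClassMapOdd_cls (z : ℚ_[ℓ]) : (sqClassMapOdd ℓ).cls z = clsOdd z := rfl

end Summit.BirchSwinnertonDyer.BirchSwinnertonDyer.Rank2Observatory.TwoDescCl.SqClassOdd
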